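import Summits.Langlands.Langlands.Theses.OrdinaryPrimeTransport
import Literature.NumberTheory.Automorphic.FontaineMazurGL2WeightOne
import Literature.NumberTheory.GaloisRepresentations.EvenGaloisRep
import HarnessLib

/-!
# SKELETON — line `ArtinWeightFMAllParitiesQ2` for the crux `ReciprocityUpToIrreducibility`
# (item stmt-Langlands-14328; routes IrreducibilityBySelfDuality / OrdinaryPrimeTransport)
# forward generator G4 ladder-down, generation 17 (unit fwd2-ladder-Langlands-14328-g17)

Dial θ20 = PARITY at ARTIN WEIGHT (Hodge–Tate `(0,0)`) in the INFINITE-IMAGE sector of clause (B) of the top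
E = `ReciprocityUpToIrreducibility`, for `GL₂` over `ℚ` at an odd prime `p`.  Family `ArtinWeightFM θ`:
binders VERBATIM the landed named fact `Literature.NumberTheory.Automorphic.Pan2022_fontaineMazurGL2_weightOne`
(Pan, Forum Math. Pi 10 (2022) e7, Thm. 1.0.5: a.e. unramified, irreducible, (TW) `ρ̄|Γ_{ℚ(ζ_p)}` absolutely
irreducible, (GEN) residually generic at `p`, de Rham of Hodge–Tate weights `(0,0)` at `p`) plus `(Set.range ρ).Infinite`,
with the parity DIALLED: `θ = 0 → ρ odd` (FLOOR cell = Pan's theorem, `floor_zero`), `θ = 1 → ρ even` (the EVEN cell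
`EvenArtinWeightInfiniteImageQ2`), `θ ≥ 2` no parity clause = THE RUNG `ArtinWeightFMAllParitiesQ2 := ArtinWeightFM 2`
(Pan's theorem with the word "odd" deleted).  The parity dichotomy over `ℚ` (`isOdd_or_isEven`, PROVED from
`IsComplexConjugation.isConj`) gives `rung_of_cells : E 0 → E 1 → rung` (PROVED), so the rung is DERIVED from the
floor fact and ONE open stub, the even cell:

  irreducible, a.e. unramified, EVEN `ρ : Γ_ℚ → GL₂(ℚ̄_p)` (`p` odd), potentially unramified at `p` (HT `(0,0)`),
  INFINITE image, (TW), (GEN)  ⇒  automorphic (an `L`-algebraic cuspidal `π` of `GL₂(𝔸_ℚ)`, a.e. Satake = Frobenius).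

Conjecturally this sector is EMPTY (Fontaine–Mazur 1995 Conj. 5a: potentially unramified at `p` + a.e. unramified ⇒
finite image), so the even cell is the infinite-image even case of the UNRAMIFIED FONTAINE–MAZUR CONJECTURE at
Taylor–Wiles level; it follows from `Langlands` (on-path lemma `ArtinWeightFMAllParitiesQ2_of_Langlands`, file
`Lines/ArtinWeightFMAllParitiesQ2_onpath.lean`) because an automorphic `ρ` of this shape would be attached to an
algebraic Maass form.  Located stop of the floor's method: every proved case is ODD — Pan's patching on the completed
cohomology of the modular curve and Calegari–Geraghty `ℓ₀ = 1` patching of weight-one coherent cohomology both need an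
odd `ρ̄` (Shimura-variety realisation); Allen–Calegari (2014) Thm. 1 proves `R^unr` is a finite `𝒪`-algebra with NO
parity hypothesis but their finite-image Cor. 3 needs "ρ̄ totally odd" to invoke modularity lifting (arXiv:1411.3759
p. 3, p. 7); Calegari's even Fontaine–Mazur theorems (tree: `Calegari2011_thm_1_2`) need DISTINCT Hodge–Tate weights.

Four registered stubs; kernel-checked composition `ReciprocityUpToIrreducibility_of : <stub₁-sig> → … → <stub₄-sig> → E`
(the rung enters through the PROVED `rung_of_cells`) and `ReciprocityUpToIrreducibility_fromStubs`:

* `stub_floorFact : Pan2022_fontaineMazurGL2_weightOne` — the floor, a theorem IN PRINT held as a named fact;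
* `stub_evenCell : EvenArtinWeightInfiniteImageQ2` — **THE OPEN CORE = BC9's cap-lifting input** (parity-free
  modularity / finiteness at repeated Hodge–Tate weight `(0,0)`);
* `stub_sectorMerge : ArtinWeightFMAllParitiesQ2 → SectorGaloisToAutomorphic` — from a.e.-Satake automorphy over `ℚ`
  to clause (B) VERBATIM (`Corresponds Rec ι π ρ` for every reciprocity datum `Rec`) on the Artin-weight sector
  `InArtinSector F ℓ ρ` (`[F:ℚ] = 1`, `ρ` with the Frobenius characteristic polynomials of `ρ₀|Γ_F` for a `ρ₀` of the
  sector: strong multiplicity one, local–global compatibility at every finite place, the pinned Fontaine datum at `p`);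
* `stub_offSector : OffSectorReciprocity` — E with clause (A′) entire and clause (B) OFF the sector (the honest rest).

TREE COPY: concludes route OrdinaryPrimeTransport's decl
`Summit.Langlands.Langlands.Theses.OrdinaryPrimeTransport.ReciprocityUpToIrreducibility` (the shared item stmt-Langlands-14328;
the IrreducibilityBySelfDuality decl is the same text verbatim — as for g3–g16 the IrreducibilityBySelfDuality Theses module does
not elaborate on the crux-write host (`remote:incoherent … mismatch`); the folder copy `line-ArtinWeightFMAllParitiesQ2.lean`
(identical up to that name) concludes `Summit.Langlands.Langlands.Theses.IrreducibilityBySelfDuality.ReciprocityUpToIrreducibility`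
BY NAME, rc 0, sorries 4 = stubs).
-/

noncomputable section

set_option linter.dupNamespace false

open scoped MatrixGroups Matrix NumberField Classical
open NumberField IsDedekindDomain Field Filter
open Literature.NumberTheory.Automorphic Literature.NumberTheory.GaloisRepresentations
open Literature.NumberTheory.PAdicHodge
open Summit.Langlands

namespace Summit.Langlands.Langlands.Cruxes.ReciprocityUpToIrreducibility.ArtinWeightFMAllParitiesQ2

/-! ## 1. The family, its cells, the rung (= `Sketch.lean` / `Lines/ArtinWeightFMAllParitiesQ2_special.lean`) -/

/-- **The rung family** `E(θ)` — parity `θ` of the Artin-weight Fontaine–Mazur statement for `GL₂/ℚ` in the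
infinite-image sector (binders verbatim `Pan2022_fontaineMazurGL2_weightOne` + infinite image; `θ = 0 → odd`,
`θ = 1 → even`, `θ ≥ 2` parity-free).
[cite: Pan2022LocallyAnalytic, Thm. 1.0.5] [cite: AllenCalegari2014, Thm. 1, Cor. 3] [cite: FontaineMazur1995, Conj. 5a] -/
def ArtinWeightFM (θ : ℕ) : Prop :=
  ∀ (p : ℕ) [Fact p.Prime], p ≠ 2 →
    ∀ (ρ : FramedGaloisRep ℚ (PadicAlgCl p) 2),
      (∀ᶠ v : HeightOneSpectrum (𝓞 ℚ) in cofinite, ρ.IsUnramifiedAt v) →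
      ρ.toGaloisRep.IsIrreducible →
      (θ = 0 → ρ.IsOdd) →
      (θ = 1 → ρ.IsEven) →
      (ρ.restrictField (CyclotomicField p ℚ)).IsResiduallyAbsIrreducible →
      (∀ v : HeightOneSpectrum (𝓞 ℚ), ((p : ℕ) : 𝓞 ℚ) ∈ v.asIdeal → IsResiduallyGenericGL2At ρ v) →
      IsDeRhamWeightZeroGL2 p ρ →
      (Set.range ⇑ρ).Infinite →
      ∀ (hcpt : isCompact_glFiniteIntegralLevel 2 ℚ) (ι : PadicAlgCl p ≃+* ℂ),
        ∃ π : CuspidalAutomorphicRepData 2 ℚ hcpt, π.1.IsLAlgebraic ∧ SatakeFrobCompatibleAE ι π.1 ρ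

/-- The ODD cell `E(0)` (the floor instance). -/
def OddArtinWeightInfiniteImageQ2 : Prop := ArtinWeightFM 0

/-- **The EVEN cell `E(1)`** — the open core: irreducible, a.e. unramified, EVEN `ρ : Γ_ℚ → GL₂(ℚ̄_p)` (`p` odd),
de Rham of Hodge–Tate weights `(0,0)` at `p`, INFINITE image, (TW), (GEN) ⇒ automorphic. -/
def EvenArtinWeightInfiniteImageQ2 : Prop := ArtinWeightFM 1

/-- **THE RUNG**: the family at `θ = 2` — NO parity hypothesis. -/
def ArtinWeightFMAllParitiesQ2 : Prop := ArtinWeightFM 2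

/-- The rung implies every cell. -/
theorem of_rung (θ : ℕ) (h : ArtinWeightFMAllParitiesQ2) : ArtinWeightFM θ := by
  intro p _ hp ρ hunr hirr _hodd _heven htw hgen hdr hinf hcpt ι
  exact h p hp ρ hunr hirr (fun h0 => absurd h0 (by norm_num)) (fun h1 => absurd h1 (by norm_num))
    htw hgen hdr hinf hcpt ι

/-- All parameters `θ ≥ 2` give the rung. -/
theorem eq_rung {θ : ℕ} (hθ : 2 ≤ θ) : ArtinWeightFM θ ↔ ArtinWeightFMAllParitiesQ2 := by
  refine ⟨fun h => ?_, of_rung θ⟩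
  intro p _ hp ρ hunr hirr _hodd _heven htw hgen hdr hinf hcpt ι
  exact h p hp ρ hunr hirr (fun h0 => absurd h0 (by omega)) (fun h1 => absurd h1 (by omega))
    htw hgen hdr hinf hcpt ι

/-- **Parity dichotomy over `ℚ` in rank two** (PROVED): all complex conjugations of `Γ_ℚ` are conjugate
(`IsComplexConjugation.isConj`), so `det ρ(c)` is independent of `c`, and `det ρ(c)² = 1` in the field `ℚ̄_p`. -/
theorem isOdd_or_isEven {p : ℕ} [Fact p.Prime] (ρ : FramedGaloisRep ℚ (PadicAlgCl p) 2) :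
    ρ.IsOdd ∨ ρ.IsEven := by
  obtain ⟨c₀, hc₀⟩ := exists_isComplexConjugation (Rat.castHom ℝ)
  have hconst : ∀ (φ : ℚ →+* ℝ) (c : absoluteGaloisGroup ℚ), IsComplexConjugation φ c →
      Matrix.GeneralLinearGroup.det (ρ c) = Matrix.GeneralLinearGroup.det (ρ c₀) := by
    intro φ c hc
    obtain rfl : φ = Rat.castHom ℝ := Subsingleton.elim _ _
    obtain ⟨u, hu⟩ := hc₀.isConj hc
    have hc' : c = (u : absoluteGaloisGroup ℚ) * c₀ * (u : absoluteGaloisGroup ℚ)⁻¹ := by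
      rw [hu.eq, mul_inv_cancel_right]
    rw [hc', map_mul, map_mul, map_inv, map_mul, map_mul, map_inv, mul_inv_eq_iff_eq_mul, mul_comm]
  have hsq := ρ.det_sq_eq_one_of_isComplexConjugation hc₀
  have hval : ((Matrix.GeneralLinearGroup.det (ρ c₀) : (PadicAlgCl p)ˣ) : PadicAlgCl p) *
      (Matrix.GeneralLinearGroup.det (ρ c₀) : PadicAlgCl p) = 1 := by
    rw [← Units.val_mul, ← sq, hsq, Units.val_one]
  rcases mul_self_eq_one_iff.mp hval with h1 | h1
  · right
    intro φ c hc
    rw [hconst φ c hc]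
    exact Units.ext (by rw [h1, Units.val_one])
  · left
    intro φ c hc
    rw [hconst φ c hc]
    exact Units.ext (by rw [h1, Units.val_neg, Units.val_one])

/-- **The rung from its two cells** (PROVED): odd cell + even cell ⇒ parity-free statement. -/
theorem rung_of_cells (hodd : ArtinWeightFM 0) (heven : EvenArtinWeightInfiniteImageQ2) :
    ArtinWeightFMAllParitiesQ2 := by
  intro p _ hp ρ hunr hirr _h0 _h1 htw hgen hdr hinf hcpt ι
  rcases isOdd_or_isEven ρ with hpar | hpar
  · exact hodd p hp ρ hunr hirr (fun _ => hpar) (fun h => absurd h (by norm_num)) htw hgen hdr hinf hcpt ι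
  · exact heven p hp ρ hunr hirr (fun h => absurd h (by norm_num)) (fun _ => hpar) htw hgen hdr hinf hcpt ι

/-- The rung is equivalent to the conjunction of its cells. -/
theorem rung_iff_cells : ArtinWeightFMAllParitiesQ2 ↔ ArtinWeightFM 0 ∧ EvenArtinWeightInfiniteImageQ2 :=
  ⟨fun h => ⟨of_rung 0 h, of_rung 1 h⟩, fun h => rung_of_cells h.1 h.2⟩

/-- **FLOOR THEOREM** (F3): Pan 2022 Thm. 1.0.5 (the landed named fact) is the odd cell. No `sorry`. -/
theorem floor_zero (h : Pan2022_fontaineMazurGL2_weightOne) : ArtinWeightFM 0 := by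
  intro p _ hp ρ hunr hirr hodd _heven htw hgen hdr _hinf hcpt ι
  exact h p hp ρ hunr hirr (hodd rfl) htw hgen hdr hcpt ι

/-- Given the floor, the rung is EXACTLY the even cell. -/
theorem rung_iff_evenCell_of_floor (h : Pan2022_fontaineMazurGL2_weightOne) :
    ArtinWeightFMAllParitiesQ2 ↔ EvenArtinWeightInfiniteImageQ2 :=
  ⟨of_rung 1, rung_of_cells (floor_zero h)⟩

/-! ## 2. The Artin-weight sector of clause (B), the merge target, the off-sector complement -/

/-- **The Artin-weight sector of clause (B)** at `(F, ℓ, ρ)`: `[F:ℚ] = 1` (so `F = ℚ`, `Γ_F = Γ_ℚ`), `ℓ` odd, and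
`ρ : Γ_F → GL_n(ℚ̄_ℓ)` has every Frobenius characteristic polynomial of `ρ₀|Γ_F` for some `ρ₀ : Γ_ℚ → GL₂(ℚ̄_ℓ)` of the
rung's sector (a.e. unramified, irreducible, (TW), (GEN), de Rham of Hodge–Tate weights `(0,0)` at `ℓ`, infinite
image) — so `ρ` "is" `ρ₀` (no cast on `n`: `HasFrobCharpolyAt` takes any polynomial). No parity condition. -/
def InArtinSector (F : Type) [Field F] [NumberField F] (ℓ : ℕ) [Fact ℓ.Prime] {n : ℕ}
    (ρ : FramedGaloisRep F (PadicAlgCl ℓ) n) : Prop :=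
  Module.finrank ℚ F = 1 ∧ ℓ ≠ 2 ∧
    ∃ ρ₀ : FramedGaloisRep ℚ (PadicAlgCl ℓ) 2,
      (∀ᶠ v : HeightOneSpectrum (𝓞 ℚ) in cofinite, ρ₀.IsUnramifiedAt v) ∧
      ρ₀.toGaloisRep.IsIrreducible ∧
      (ρ₀.restrictField (CyclotomicField ℓ ℚ)).IsResiduallyAbsIrreducible ∧
      (∀ v : HeightOneSpectrum (𝓞 ℚ), ((ℓ : ℕ) : 𝓞 ℚ) ∈ v.asIdeal → IsResiduallyGenericGL2At ρ₀ v) ∧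
      IsDeRhamWeightZeroGL2 ℓ ρ₀ ∧
      (Set.range ⇑ρ₀).Infinite ∧
      ∀ (w : HeightOneSpectrum (𝓞 F)) (P : Polynomial (PadicAlgCl ℓ)),
        (ρ₀.restrictField F).HasFrobCharpolyAt w P → ρ.HasFrobCharpolyAt w P

/-- **Merge target**: clause (B) of E VERBATIM (cuspidal, `L`-algebraic, `Corresponds Rec ι π ρ` — a.e. Satake AND
local–global compatibility at every finite place) for EVERY reciprocity datum `Rec`, on the Artin-weight sector. -/
def SectorGaloisToAutomorphic : Prop :=
  ∀ (F : Type) [Field F] [NumberField F] (Rec : ReciprocityData F) (n : ℕ), 0 < n →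
    ∀ (hcpt : isCompact_glFiniteIntegralLevel n F) (ℓ : ℕ) [Fact ℓ.Prime] (ι : PadicAlgCl ℓ ≃+* ℂ)
      (ρ : FramedGaloisRep F (PadicAlgCl ℓ) n),
      ρ.toGaloisRep.IsIrreducible → IsGeometricFramed Rec ρ → InArtinSector F ℓ ρ →
        ∃ π : CuspidalAutomorphicRepData n F hcpt, π.1.IsLAlgebraic ∧ Corresponds Rec ι π.1 ρ

/-- **The off-sector complement**: E (`ReciprocityUpToIrreducibility`) with clause (A′) entire and clause (B)
restricted to `ρ` NOT in the Artin-weight sector. -/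
def OffSectorReciprocity : Prop :=
  ∀ (F : Type) [Field F] [NumberField F], ∃ Rec : ReciprocityData F, ∀ n : ℕ, 0 < n →
    ∀ hcpt : isCompact_glFiniteIntegralLevel n F,
      (∀ π : CuspidalAutomorphicRepData n F hcpt, π.1.IsLAlgebraic →
        ∀ (ℓ : ℕ) [Fact ℓ.Prime] (ι : PadicAlgCl ℓ ≃+* ℂ),
          ∃ ρ : FramedGaloisRep F (PadicAlgCl ℓ) n, IsGeometricFramed Rec ρ ∧ Corresponds Rec ι π.1 ρ) ∧
      (∀ (ℓ : ℕ) [Fact ℓ.Prime] (ι : PadicAlgCl ℓ ≃+* ℂ) (ρ : FramedGaloisRep F (PadicAlgCl ℓ) n),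
        ρ.toGaloisRep.IsIrreducible → IsGeometricFramed Rec ρ → ¬ InArtinSector F ℓ ρ →
          ∃ π : CuspidalAutomorphicRepData n F hcpt, π.1.IsLAlgebraic ∧ Corresponds Rec ι π.1 ρ)

/-! ## 3. The four registered stubs -/

/-- The floor: Pan 2022 Thm. 1.0.5, a theorem in print held as a named fact (floor debt).
[cite: Pan2022LocallyAnalytic, Thm. 1.0.5] -/
theorem stub_floorFact : Pan2022_fontaineMazurGL2_weightOne := by
  sorry

/-- **THE OPEN CORE / cap-lifting input**: the EVEN cell — parity-free automorphy (conjecturally: non-existence,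
Fontaine–Mazur Conj. 5a) of irreducible even `ρ : Γ_ℚ → GL₂(ℚ̄_p)` of Hodge–Tate weights `(0,0)` with infinite image
at Taylor–Wiles level.  OPEN (Allen–Calegari Thm. 1 gives `R^unr` finite over `𝒪` without parity; the step
"finite over `𝒪` ⇒ finite image / automorphic" is known only for odd `ρ̄`). -/
theorem stub_evenCell : EvenArtinWeightInfiniteImageQ2 := by
  sorry

/-- Sector merge: from a.e.-Satake automorphy over `ℚ` on the whole Artin-weight infinite-image sector (both parities)
to clause (B) of E verbatim on `InArtinSector`, for every `Rec` (`[F:ℚ] = 1` transport, strong multiplicity one ⇒ the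
cuspidal `π`; local–global compatibility at every finite place; the `v ∣ ℓ` clause against the pinned Fontaine datum). -/
theorem stub_sectorMerge : ArtinWeightFMAllParitiesQ2 → SectorGaloisToAutomorphic := by
  sorry

/-- The honest complement: E off the Artin-weight sector. -/
theorem stub_offSector : OffSectorReciprocity := by
  sorry

/-! ## 4. Composition (no sorry below this line) -/

/-- The rung from the stubs that carry it (floor fact + even cell), via the PROVED parity dichotomy. -/
theorem rung_of_floorFact_of_evenCell (hfloor : Pan2022_fontaineMazurGL2_weightOne)
    (heven : EvenArtinWeightInfiniteImageQ2) : ArtinWeightFMAllParitiesQ2 :=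
  rung_of_cells (floor_zero hfloor) heven

/-- **COMPOSITION — the crux BY NAME from the four stub statements.**  `Rec` and clause (A′) come from the
off-sector statement; clause (B) is a case split on the Artin-weight sector, where the RUNG (assembled from the floor
fact and the even cell by `rung_of_cells`) feeds the merge. -/
theorem ReciprocityUpToIrreducibility_of :
    Pan2022_fontaineMazurGL2_weightOne → EvenArtinWeightInfiniteImageQ2 →
    (ArtinWeightFMAllParitiesQ2 → SectorGaloisToAutomorphic) → OffSectorReciprocity →
    Summit.Langlands.Langlands.Theses.OrdinaryPrimeTransport.ReciprocityUpToIrreducibility := by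
  intro hfloor heven hmerge hoff F _ _
  obtain ⟨Rec, hall⟩ := hoff F
  refine ⟨Rec, fun n hn hcpt => ⟨(hall n hn hcpt).1, ?_⟩⟩
  intro ℓ _ ι ρ hirr hgeo
  by_cases hsec : InArtinSector F ℓ ρ
  · exact hmerge (rung_of_floorFact_of_evenCell hfloor heven) F Rec n hn hcpt ℓ ι ρ hirr hgeo hsec
  · exact (hall n hn hcpt).2 ℓ ι ρ hirr hgeo hsec

/-- **THE REGISTERED SKELETON THEOREM** — the item's decl from the four registered stubs (audit: proof-of-item
modulo the four sorries). -/
theorem ReciprocityUpToIrreducibility_fromStubs :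
    Summit.Langlands.Langlands.Theses.OrdinaryPrimeTransport.ReciprocityUpToIrreducibility :=
  ReciprocityUpToIrreducibility_of stub_floorFact stub_evenCell stub_sectorMerge stub_offSector

/-- The rung from the registered stubs (it is load-bearing: `ReciprocityUpToIrreducibility_of` passes through it). -/
theorem rung_of_stubs : ArtinWeightFMAllParitiesQ2 :=
  rung_of_floorFact_of_evenCell stub_floorFact stub_evenCell

/-! ## 5. The rung is a consequence of the top and of the summit (sorry-free) -/

/-- `E → ArtinWeightFM θ` for every `θ` (clause (B) of E over `ℚ`, `n = 2`, for its own `Rec`). -/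
theorem artinWeightFM_of_top (θ : ℕ)
    (hE : Summit.Langlands.Langlands.Theses.OrdinaryPrimeTransport.ReciprocityUpToIrreducibility) :
    ArtinWeightFM θ := by
  intro p _ _hp ρ hunr hirr _hodd _heven _htw _hgen hdr _hinf hcpt ι
  obtain ⟨Rec, hall⟩ := hE ℚ
  have hB : GaloisToAutomorphic 2 Rec hcpt := (hall 2 two_pos hcpt).2
  have hdR : ∀ (v : HeightOneSpectrum (𝓞 ℚ)) (hv : ((p : ℕ) : 𝓞 ℚ) ∈ v.asIdeal),
      (Rec.pst p v hv).IsDeRhamFramed (ρ.toLocal v) := by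
    intro v hv
    change (fontainePstAdicCompletion v p hv).IsDeRhamFramed (ρ.toLocal v)
    exact (hdr v hv).1
  obtain ⟨π, hπL, hcorr⟩ := hB p ι ρ hirr ⟨hunr, hdR⟩
  exact ⟨π, hπL, hcorr.1⟩

/-- `E → rung`. -/
theorem ArtinWeightFMAllParitiesQ2_of_top
    (hE : Summit.Langlands.Langlands.Theses.OrdinaryPrimeTransport.ReciprocityUpToIrreducibility) :
    ArtinWeightFMAllParitiesQ2 :=
  artinWeightFM_of_top 2 hE

/-- `Langlands → ArtinWeightFM θ` for every `θ` (the F4 on-path lemma, also in `_onpath`). -/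
theorem artinWeightFM_of_langlands (θ : ℕ) (hL : _root_.Langlands) : ArtinWeightFM θ := by
  intro p _ _hp ρ hunr hirr _hodd _heven _htw _hgen hdr _hinf hcpt ι
  obtain ⟨⟨Rec⟩, hall⟩ := hL ℚ
  have hB : GaloisToAutomorphic 2 Rec hcpt := (hall Rec 2 two_pos hcpt).2
  have hdR : ∀ (v : HeightOneSpectrum (𝓞 ℚ)) (hv : ((p : ℕ) : 𝓞 ℚ) ∈ v.asIdeal),
      (Rec.pst p v hv).IsDeRhamFramed (ρ.toLocal v) := by
    intro v hv
    change (fontainePstAdicCompletion v p hv).IsDeRhamFramed (ρ.toLocal v)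
    exact (hdr v hv).1
  obtain ⟨π, hπL, hcorr⟩ := hB p ι ρ hirr ⟨hunr, hdR⟩
  exact ⟨π, hπL, hcorr.1⟩

/-- **F4 on-path lemma for the rung**: `Langlands → ArtinWeightFMAllParitiesQ2`. -/
theorem ArtinWeightFMAllParitiesQ2_of_Langlands (hL : _root_.Langlands) : ArtinWeightFMAllParitiesQ2 :=
  artinWeightFM_of_langlands 2 hL

end Summit.Langlands.Langlands.Cruxes.ReciprocityUpToIrreducibility.ArtinWeightFMAllParitiesQ2

end
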